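/- Copyright: the b2b-balaban cell (near-miss cell 7), T⁴-continuum fan-out; row NE7b CRUX team (2), seat
t4-ne7b-formalise-leaf-03 (gen 26) — custodian's PRE-BUILD of the OWNER's SPEC IR-46-2 «THE (α) ASSEMBLY» v0
(`HOME/t4/b2b-balaban-t4-ne7b-p1/g46/SPEC-IR-46-2-ASSEMBLY.v0.md`, journal l.31761 ∕ answers l.31857) made IR-46-2 PROPER by RULING
R-OWNER-47-2 (journal l.31988: run B v0.5 over the owner's M2-C `B16HistoryIndexedTrunc`), part 1 of 2: the bundled inputs.  Released under the licence of the surrounding project. -/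
import Summits.QuantumFields.BalabanUV.T4Continuum.Support.HistoryRealiseCellsRunApexT3bWTVS
import Summits.QuantumFields.BalabanUV.T4Continuum.Support.HistoryRealiseCellsRunSupplyKeysWTVS
import Summits.QuantumFields.BalabanUV.T4Continuum.Support.B16HistoryIndexedTrunc

/-!
# THE (α) ASSEMBLY, part 1: THE BUNDLED INPUTS `HistReadData` of the VS-witness over M2 brick B's reading of (1.72)
(re-open object (α) of row NE7b; SPEC IR-46-2 v0 §2; lineage `t4-ne7b-formalise-leaf-03` gen 26, custodian of the S12-W crew)

Summits-side support leaf of the T⁴-continuum cell (rung (B)+1 on a FINITE torus only; NOT infinite volume, NOT the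
mass gap, NOT the Clay statement; NOT a proof of the spine estimate NE7b — the cell's OWN estimate, NOT PRINTED, NOT
PROVED).  [folklore] ONE `structure` (a hypothesis SHAPE: data + located displays, NOTHING of Bałaban's asserted) and four
reducible abbreviations for the reading's carriers; no `[cite:]` tag, no `Prop` fact minted, zero `sorry`.

WHAT.  `cellA`∕`memA`∕`physA`∕`kmemA` — the END's root-cell map, named family, physical datum and key family AT THE READING
(`cellOfR n F.L (runProfile F.L ℛ.R) ℛ.inputOf.pedV (fun _ _ => id)`, `memOf …`, `physV …`, `kmemOf …` — the witness's own
carriers at `ped := ℛ.inputOf.pedV`, `cellP := fun _ _ => id`, `liveC := ℛ.inputOf.liveCV`, `T := HIndex.termSet I`,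
`R := ℛ.R`).  **`structure HistReadData`** = SPEC §2, field for field: the apex data (`l₀ vol K₀`); RUN A's M1∕M2-A data over
NODE O's synchronised skeleton `I` (`RA`, `ρA`; displays `holdsA`, `intA`, `H2A`); M2-B's reading `ℛ` WITH (c1)'s two
equations `ℛ.L = F.L`, `ℛ.s = runProfile F.L ℛ.R` and factor data `Φf`, THE identification `HistRead`, the (2.5) display
`isRj` and `1 ≤ R` on `ℛ.R`, the pass-V input conditions per term; the constants' side conditions; M5-2's calibrated volume
displays per cutoff; M5-3∕M5-4's letter families `sB sR φB φR` with `FactorRead`, `RoundingRoomF`, `FlowIneq29` per cutoff;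
M5-2c's `huV`; (ρ) `FibreMass` with the curly normalisation envelope `W` and the term-free envelopes `W∞`, `BA∞`, `m∞`;
(γ)∕sites; the two S1c-opt reading clauses `hDJ`∕`hBB` displayed ((c5)(i), re-pluggable by a crew module); NE7c's `shell` and
NE7's `budget` + rates OVER THIS READING's carriers (S); the flow's K-class facts on the run's own profile (`4 ≤ F.L`,
monotonicity and drop control of `runProfile F.L ℛ.R K` — `runProfile_succ_le` ∕ `dropCtl_runProfile` at the headline); RUN B
v0.5 (R-OWNER-47-2 (A)(iii)): run B's own M1∕M2-A data at cutoff `K + 1` over its skeleton `I′` (`RB`, `ρB`; displays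
`holdsB`∕`intB`∕`H2B`), the truncation `trunc : ℕ → Idx I′ → Idx I` with `MapsTo` into `termSet I K` (S, NODE O), run B's
per-term dead weights `dB` with the numerator readings KEYED AT RUN A's KEYS (`upB`, `deadB_nonneg`: R «TRUNC») against the
live price `LIVEOf` at run B's sharp letters `sB′ sR′`, the composite-fibre mass display (ρ′) `resumB` against
`MULTOf (sharpT φB′ φR′)`, the booked junction `RoundingRoomF` at run B's letters, and the envelope `mup` with its bound —
so that part 2 DERIVES `A′ := weightB νB RB trunc`, `reprB` (M2-C `reprB_of_holds_trunc`), `dead′ := aggW … dB`,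
`upM′`∕`deadM′_nonneg`∕`resumM′` (M2-C `upM'_of_trunc` ∕ `deadM'_nonneg_of_trunc` ∕ `resumM'_of_trunc`), `FcM′`∕`RfM′`∕`priceM′`∕
`FM′_nonneg` (B′'s letters at run B's sharps, the sibling's `priceM_of_reading` ∕ `FM_nonneg_of_reading`).  Part 2
(`HistoryRealiseCellsRunAssemblyWTVS`) builds `Nonempty (CountRoadWitnessT3bWTVS …)` from it.

HONEST SCOPE.  A bundling of HYPOTHESES; the R∕S class of every field is SPEC §5's; nothing discharged here.  NE7b NOT
proved; spine 0∕9.  HONEST DEPENDENCY (cell): continuum YM on T⁴ ⇐ BetaPertH ∧ nine spine estimates (0/9 proved); BetaPertH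
⇐ (D1) ∧ (D4) ∧ CAP+tail; G-an2-4 gates asym, D1 and NE2/3/4.  This file changes none of it.
SUPERSESSION-OF-RECORD MARKING (v1.1, owner gen 53, DOCSTRING ONLY — every declaration, field, `import` and `open` line of
v1 = p279430 byte-identical; referee OI-77; R-OWNER-48-1 «THE GUARDED CUT»).  SUPERSEDED IN PLACE FOR INHABITATION: the field
`hDJ` of `HistReadData` is typed in the UNGUARDED currency `HistoryRealiseDistinct.DisjointJoins`, MISSTATED AS TYPED — it is
unsatisfiable for any reading with a live join (`HistoryRealiseDistinctGuarded.Sanity.not_disjointJoins_nestedToy`), so this record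
is inhabited only by the no-region toy (`nonempty_histReadData_toyData` p288154).  OF RECORD INSTEAD: `HistReadDataL` (L4, p283718 —
THIS record with `hDJ`∕`hBB`∕`hbox` replaced by the input display `hreg : RegionsInBox`, the guarded clause `DisjointJoinsL` being
PROVED on pass V by `InputFamily.disjointJoinsL_pedV`) and its descendants `HistReadDataLW`∕`LWD`∕`LWK`∕`LP` (p289955 ∕ p294821 ∕
p297996 ∕ p299868); `HistReadData.toL` (in `…AssemblyWTVSL` p287559) embeds this record into the road of record.
-/

open Finset MeasureTheory
open Literature.MathematicalPhysics.QuantumFieldTheory.Balaban1983to89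
open T4PersistenceDictionary T4PersistentHistoryCount T4BankedInduction T4PrintedShapeBanking
open T4WeightBudget T4GlobalDenominator T4LiveClassFibration T4LiveStructureGas T4LiveGasToTerms T4RecordPriceSeam
open T4PartnerMultiplicity T4IndicatorShell T4MatchingAssembly T4MatchingClosure T4MatchingClosureSocket T4Continuum
open T4StabilitySocket T4BranchingRecordsGas T4TaggedShapeBanking T4CanonicalMenus T4RenewalChains
open Summit.QuantumFields.BalabanUV.T4Continuum.PlacementBatch Summit.QuantumFields.BalabanUV.T4Continuum.PlacementSkeleton
open Summit.QuantumFields.BalabanUV.T4Continuum.CountThresholdUniform Summit.QuantumFields.BalabanUV.T4Continuum.CountThresholdExit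
open Summit.QuantumFields.BalabanUV.T4Continuum.CountSeamJunction Summit.QuantumFields.BalabanUV.T4Continuum.LateMergers
open Summit.QuantumFields.BalabanUV.T4Continuum.HistoryFlow Summit.QuantumFields.BalabanUV.T4Continuum.HistoryRegeneration
open Summit.QuantumFields.BalabanUV.T4Continuum.HistoryTables Summit.QuantumFields.BalabanUV.T4Continuum.HistoryAssemblyTrees
open Summit.QuantumFields.BalabanUV.T4Continuum.HistoryAssemblyTerms Summit.QuantumFields.BalabanUV.T4Continuum.HistoryAssemblyPedigree
open Summit.QuantumFields.BalabanUV.T4Continuum.HistoryConstants Summit.QuantumFields.BalabanUV.T4Continuum.HistoryGen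
open Literature.MathematicalPhysics.QuantumFieldTheory.Balaban1983to89.B13ScaleTransfer
open Summit.QuantumFields.BalabanUV.T4Continuum.ZoneSkeleton Summit.QuantumFields.BalabanUV.T4Continuum.HistorySocketTH
open Summit.QuantumFields.BalabanUV.T4Continuum.HistoryCaps Summit.QuantumFields.BalabanUV.T4Continuum.HistoryAssemblyPrice
open Summit.QuantumFields.BalabanUV.T4Continuum.HistoryBankingLE Summit.QuantumFields.BalabanUV.T4Continuum.HistoryExitLE
open Summit.QuantumFields.BalabanUV.T4Continuum.HistoryAssemblyTreesLE Summit.QuantumFields.BalabanUV.T4Continuum.HistoryAssemblyTermsLE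
open Summit.QuantumFields.BalabanUV.T4Continuum.HistoryRealise Summit.QuantumFields.BalabanUV.T4Continuum.HistoryAssemblyRealiseLE
open Summit.QuantumFields.BalabanUV.T4Continuum.HistoryAssemblyMult Summit.QuantumFields.BalabanUV.T4Continuum.HistoryAssemblyMultKey
open Summit.QuantumFields.BalabanUV.T4Continuum.HistoryAssemblyRealiseRun Summit.QuantumFields.BalabanUV.T4Continuum.HistoryAssemblyRealiseMult
open Summit.QuantumFields.BalabanUV.T4Continuum.HistoryZones Summit.QuantumFields.BalabanUV.T4Continuum.HistoryRealiseCells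
open Summit.QuantumFields.BalabanUV.T4Continuum.HistoryRealiseCellsRun Summit.QuantumFields.BalabanUV.T4Continuum.HistoryAssemblyRealiseRunMult
open Summit.QuantumFields.BalabanUV.T4Continuum.HistoryRealiseCellsRunMult Summit.QuantumFields.BalabanUV.T4Continuum.HistoryAssemblyMultInstance
open Summit.QuantumFields.BalabanUV.T4Continuum.HistoryJoinsPlacedMember Summit.QuantumFields.BalabanUV.T4Continuum.PlacementSkeleton
open Summit.QuantumFields.BalabanUV.T4Continuum.HistoryJoinsPlacedMult Summit.QuantumFields.BalabanUV.T4Continuum.HistoryRealiseDistinct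
open Summit.QuantumFields.BalabanUV.T4Continuum.HistoryRegionTemplates Summit.QuantumFields.BalabanUV.T4Continuum.HistoryCaps
open Summit.QuantumFields.BalabanUV.T4Continuum.HistoryZoneEvolve (cth)
open Literature.MathematicalPhysics.QuantumFieldTheory.Balaban1983to89.B16SProfile (DropCtl)
open Summit.QuantumFields.BalabanUV.T4Continuum.HistoryRealiseCellsRunMultEnd Summit.QuantumFields.BalabanUV.T4Continuum.HistoryRealiseCellsRunMultEndD
open Summit.QuantumFields.BalabanUV.T4Continuum.HistoryRealiseCellsRunPinnedT3b Summit.QuantumFields.BalabanUV.T4Continuum.HistoryHybridRescale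
open Summit.QuantumFields.BalabanUV.T4Continuum.HistoryRealiseCellsRunApex (exists_const_schemeZ)
open Summit.QuantumFields.BalabanUV.T4Continuum.HistoryRealisePrint Summit.QuantumFields.BalabanUV.T4Continuum.HistoryRealiseWeak
open Summit.QuantumFields.BalabanUV.T4Continuum.HistoryRealisePrintReading Summit.QuantumFields.BalabanUV.T4Continuum.HistoryRealiseWeakReading
open Summit.QuantumFields.BalabanUV.T4Continuum.HistoryRealisePrintCells Summit.QuantumFields.BalabanUV.T4Continuum.HistoryRealiseWeakCells
open Summit.QuantumFields.BalabanUV.T4Continuum.HistoryRealiseCellsRunApexT3b Summit.QuantumFields.BalabanUV.T4Continuum.HistoryRealiseCellsRunApexT3bW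

open Summit.QuantumFields.BalabanUV.T4Continuum.HistoryRealiseCellsRunApexT3bWT Summit.QuantumFields.BalabanUV.T4Continuum.HistoryRealiseCellsRunPinnedT3bWT
open Summit.QuantumFields.BalabanUV.T4Continuum.HistoryRealiseCellsRunHeadlineT3bWT
open Summit.QuantumFields.BalabanUV.T4Continuum.HistoryRealiseCellsRunApexT3bWTV Summit.QuantumFields.BalabanUV.T4Continuum.HistoryBankingVolumePlug
open Summit.QuantumFields.BalabanUV.T4Continuum.HistoryRealiseCellsRunApexT3bWTVS
open Summit.QuantumFields.BalabanUV.T4Continuum.HistoryGenealogyRealise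
open Summit.QuantumFields.BalabanUV.T4Continuum.HistoryGenealogyInstantiate
open Summit.QuantumFields.BalabanUV.T4Continuum.B16HistoryIndexedRepr
open Summit.QuantumFields.BalabanUV.T4Continuum.B16HistoryIndexedTrunc
open Summit.QuantumFields.BalabanUV.T4Continuum.HistoryBankingDiscountCharge
open Summit.QuantumFields.BalabanUV.T4Continuum.HistoryBankingCreditRead
open Summit.QuantumFields.BalabanUV.T4Continuum.HistoryBankingFibreRoom
open Summit.QuantumFields.BalabanUV.T4Continuum.HistoryPriceKeys
open Summit.QuantumFields.BalabanUV.T4Continuum.HistoryRealiseCellsRunSupplyWTVS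
open Summit.QuantumFields.BalabanUV.T4Continuum.HistoryRealiseCellsRunSupplyKeysWTVS

namespace Summit.QuantumFields.BalabanUV.T4Continuum.HistoryRealiseCellsRunAssemblyWTVSData

noncomputable section

set_option synthInstance.maxSize 1024

/-! ## §1 The reading's carriers (the witness's own, at `ped := ℛ.inputOf.pedV`, `cellP := id`, `T := termSet I`, `R := ℛ.R`) -/

section Carriers

variable {DomK : ℕ → Type*} {I : (K : ℕ) → HIndex (DomK K)} {d : ℕ}

/-- the root-cell map at the reading [folklore] -/
abbrev cellA (n L : ℕ) (ℛ : HistReading I d) : ℕ → HIndex.Idx I → ℕ × Lab d → (Fin d → ℕ) :=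
  cellOfR n L (runProfile L ℛ.R) ℛ.inputOf.pedV (fun _ _ => id)

/-- the named member family at the reading [folklore] -/
abbrev memA (n L : ℕ) (ℛ : HistReading I d) : ℕ → HIndex.Idx I → Finset ((Fin d → ℕ) × Gen (Lab (ℕ × Lab d) (Lab d))) :=
  memOf ℛ.inputOf.pedV ℛ.inputOf.liveCV (cellA n L ℛ)

/-- the physical datum of record at the reading [folklore] -/
abbrev physA (n L : ℕ) (hn : 0 < n) (hL : 0 < L) (ℛ : HistReading I d) :
    ℕ → HIndex.Idx I → ℕ × Lab d → Multiset (PEv × ((Fin d → ℕ) × Finset (Pt d))) :=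
  physV n L hn hL (fun K => tcap d (dcapOf Prod.fst (HIndex.termSet I) (memA n L ℛ) K))
    (fun K => one_le_tcap d (dcapOf Prod.fst (HIndex.termSet I) (memA n L ℛ) K)) (runProfile L ℛ.R) ℛ.inputOf.pedV
    (fun _ _ => id)

/-- the key family at the reading [folklore] -/
abbrev kmemA (n L : ℕ) (hn : 0 < n) (hL : 0 < L) (ℛ : HistReading I d) :
    ℕ → HIndex.Idx I → Finset ((Fin d → ℕ) × Gen PEv × Multiset (PEv × ((Fin d → ℕ) × Finset (Pt d)))) :=
  kmemOf ℛ.inputOf.pedV ℛ.inputOf.liveCV (cellA n L ℛ) (physA n L hn hL ℛ)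

end Carriers

/-! ## §2 The bundled inputs -/

section Data

variable {F : T4Family} {G : Type*} [GaugeGroup G] [MeasurableSpace G] [HaarData G] [RegularGaugeGroup G]

/-- **THE INPUTS OF THE (α) ASSEMBLY** (SPEC IR-46-2 v0 §2; HYPOTHESIS SHAPE — data + located displays, NOTHING of
Bałaban's asserted).  RUN A over M2 brick B's reading `ℛ` of (1.72) in the pass-V currency; RUN B v0 displayed under
«TRUNC»; NE7c ∕ NE7 over this reading's carriers. [folklore] -/
structure HistReadData (D : FiniteEpsData F G) (C : T4PrintedShapeBanking.Consts) (O : PrintedO1s) (θv : ℝ)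
    (rr d n : ℕ) (hn : 0 < n) (g₀ : ℕ → ℝ) (os : List (ULoop F)) {DomK : ℕ → Type}
    (I : (K : ℕ) → HIndex (DomK K)) [DecidableEq (HIndex.Idx I)] {DomK' : ℕ → Type} (I' : (K : ℕ) → HIndex (DomK' K))
    (X : ℕ → Type) [∀ K, MeasurableSpace (X K)] (μ : (K : ℕ) → Measure (X K)) [∀ K, IsFiniteMeasure (μ K)]
    (𝒢 : (K : ℕ) → GoodClass (X K)) (Y : ℕ → Type) [∀ K, MeasurableSpace (Y K)] (νB : (K : ℕ) → Measure (Y K))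
    [∀ K, IsFiniteMeasure (νB K)] (𝒢' : (K : ℕ) → GoodClass (Y K)) where
  /-- the source radius -/
  l₀ : ℝ
  /-- the volume factor of the matching remainders -/
  vol : ℝ
  /-- the source radius is positive -/
  l₀_pos : 0 < l₀
  /-- the volume factor is positive -/
  vol_pos : 0 < vol
  /-- the threshold in the number of steps -/
  K₀ : ℕ
  /-- M1∕M2-A: run A's history-indexed operations over the skeleton, per cutoff and source value -/
  RA : (K : ℕ) → ℝ → Repr172R (𝒢 K) (I K)
  /-- M1∕M2-A: run A's dressed density on its reference space -/
  ρA : (K : ℕ) → ℝ → X K → ℝ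
  /-- display ((1.72) holds): the density is the sum of the level's terms -/
  holdsA : ∀ K t V, ρA K t V = ∑ a : (I K).Adm, (RA K t).term a V
  /-- display (integrability of the elementary terms) -/
  intA : ∀ K t a, ∀ ι ∈ (I K).LIdx a, Integrable ((RA K t).eterm a ι) (μ K)
  /-- display (H2: the dressed push-forward identity) -/
  H2A : ∀ K t, |t| ≤ l₀ → K₀ ≤ K →
    ∫ U, Real.exp (t * T4GenFunBounds.prodObs (D.scheme g₀) K os U) * D.dens K (g₀ K) 0 U ∂fieldMeasure (F.P K) 0 G =
      ∫ x, ρA K t x ∂μ K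
  /-- M2-B: the reading of the history choices (regions, classes, cubes; flow, memory) -/
  ℛ : HistReading I d
  /-- (c1) the reading's blocking parameter is the family's -/
  hL : ℛ.L = F.L
  /-- (c1) the reading's exponent profile is the run's own -/
  hs : ℛ.s = runProfile F.L ℛ.R
  /-- M2-B: the factor values and envelopes -/
  Φf : HistFactors I d
  /-- display: THE identification `HistRead` -/
  hR : HistRead ℛ Φf RA l₀ K₀
  /-- display (2.5): the reading's sizes are admissible for the running couplings -/
  isRj : ∀ K s, s ≤ K → B14.IsRj F.L rr ((D.C ⟨K, F.m, g₀ K⟩).flow.g s) (ℛ.R K s)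
  /-- sizes are at least one -/
  one_le_R : ∀ K, K₀ ≤ K → ∀ t, 1 ≤ ℛ.R K t
  /-- flow (K): the blocking parameter is at least four -/
  hL4 : 4 ≤ F.L
  /-- flow (K): the run's own exponent profile is non-increasing within the run (`runProfile_succ_le`) -/
  hprof : ∀ K, K₀ ≤ K → ∀ t, t < K → runProfile F.L ℛ.R K (t + 1) ≤ runProfile F.L ℛ.R K t
  /-- flow (K): drop control of the run's own profile (`dropCtl_runProfile`) -/
  hdrop : ∀ K, K₀ ≤ K → ∀ m, DropCtl (runProfile F.L ℛ.R K) m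
  /-- pass-V input condition per term: new regions consistent -/
  hN : ∀ K, K₀ ≤ K → ∀ τ ∈ HIndex.termSet I K, (ℛ.inputOf.run K τ).NewOK
  /-- pass-V input condition per term: memory domination -/
  hRm : ∀ K, K₀ ≤ K → ∀ τ ∈ HIndex.termSet I K, ∀ t k, (ℛ.inputOf.run K τ).Rm t k ≤ (ℛ.inputOf.run K τ).R t
  /-- pass-V input condition per term: memory domination, one-step form -/
  hRmS : ∀ K, K₀ ≤ K → ∀ τ ∈ HIndex.termSet I K, ∀ t k, (ℛ.inputOf.run K τ).Rm t (k + 1) ≤ (ℛ.inputOf.run K τ).R (t + 1)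
  /-- pass-V input condition per term: non-degenerate memory -/
  hRm2 : ∀ K, K₀ ≤ K → ∀ τ ∈ HIndex.termSet I K, ∀ t, 2 ≤ (ℛ.inputOf.run K τ).Rm t 1
  /-- pass-V input condition per term: disjoint new regions -/
  hD : ∀ K, K₀ ≤ K → ∀ τ ∈ HIndex.termSet I K, (ℛ.inputOf.run K τ).NewDisjoint
  /-- pass-V input condition per term: the box condition -/
  hbox : ∀ K, K₀ ≤ K → ∀ τ ∈ HIndex.termSet I K, (ℛ.inputOf.run K τ).InBoxOK n K
  /-- constants: the window constant, the discount letters -/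
  hn₁ : 13 ≤ C.n₁
  /-- constants -/
  hE₂ : 0 < C.E₂
  /-- constants -/
  hE₃ : 0 ≤ C.E₃
  /-- M5-2 volume calibration per cutoff: growth constant of the per-cube level cost over the lag -/
  Lu : ℕ → ℝ
  /-- M5-2 volume calibration per cutoff: the lag -/
  jl : ℕ → ℕ
  /-- display -/
  hLu0 : ∀ K, K₀ ≤ K → 0 < Lu K
  /-- display -/
  hj1 : ∀ K, K₀ ≤ K → 1 ≤ jl K
  /-- display -/
  hLu : ∀ K, K₀ ≤ K → ∀ t i, i ≤ jl K → Real.log (Φf.Λ K (t + i)) ≤ Lu K * Real.log (Φf.Λ K t)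
  /-- display -/
  hsmall : ∀ K, K₀ ≤ K → (1122 : ℝ) ^ d * 16 * 21 ^ d * Lu K ≤ 2 ^ jl K / 2
  /-- display -/
  huΦ : ∀ K, K₀ ≤ K → ∀ t, t ≤ K →
    Real.log (Φf.Λ K t) * (6 * (561 ^ d * jl K * Lu K + 1122 ^ d * Lu K)) ≤ floorK C K (ℛ.R K) t
  /-- display -/
  huE₂ : ∀ K, K₀ ≤ K → ∀ m, m ≤ K → Real.log (Φf.Λ K m) * (15 * 126 ^ d) ≤ C.E₂ * (ℛ.R K m : ℝ) ^ C.q'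
  /-- display -/
  huE₃ : ∀ K, K₀ ≤ K → ∀ m, m ≤ K → Real.log (Φf.Λ K m) * (24 * 126 ^ d) ≤ C.E₃ * (ℛ.R K m : ℝ) ^ C.q'
  /-- M5-3∕M5-4 letters per cutoff: sharp birth exponents -/
  sB : ℕ → ℕ → ℕ → ℝ
  /-- sharp renewal exponents -/
  sR : ℕ → ℕ → ℝ
  /-- fibre shares, births -/
  φB : ℕ → ℕ → ℕ → ℝ
  /-- fibre shares, renewals -/
  φR : ℕ → ℕ → ℝ
  /-- (2.9)'s letters -/
  β' : ℝ
  /-- (2.9)'s letters -/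
  β₀ : ℝ
  /-- display: the factor reading -/
  hF : ∀ K, K₀ ≤ K → FactorRead (Φf.fB K) (Φf.fR K) (sB K) (sR K)
  /-- display: the rounding-with-room junction with the fibre share booked -/
  hRR : ∀ K, K₀ ≤ K → RoundingRoomF C O F.L K (ℛ.R K) (D.C ⟨K, F.m, g₀ K⟩).flow.g (sB K) (sR K) (φB K) (φR K)
  /-- display (2.9) on the reading's sizes -/
  h29 : ∀ K, K₀ ≤ K → B14FlowStep.FlowIneq29 (ℛ.R K) (D.C ⟨K, F.m, g₀ K⟩).flow.g F.L β' β₀ K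
  /-- display M5-2c (D-V1 at the calibrated weight): `2^{d+3}·log Λ K j ≤ θᵥ·p₀(g_j)²` at the priced members' births -/
  huV : ∀ K, K₀ ≤ K → ∀ τ ∈ badTerms (memA n F.L ℛ) jhalf (HIndex.termSet I) K, ∀ q ∈ memA n F.L ℛ K τ,
    ∀ e ∈ q.2.events, (Prod.fst e).kind = 0 →
      2 ^ (d + 3) * Real.log (Φf.Λ K (Prod.fst e).step) ≤
        θv * p0Profile C.A₀ C.p₀ ((D.C ⟨K, F.m, g₀ K⟩).flow.g (Prod.fst e).step) ^ 2
  /-- the term-free curly normalisation envelope -/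
  W : ℕ → ℝ
  /-- display -/
  one_le_W : ∀ K, 1 ≤ W K
  /-- the term-free envelopes' K-uniform bounds -/
  (Wi BAi mi : ℝ)
  /-- display -/
  hWi : ∀ K, W K ≤ Wi
  /-- display -/
  hBA : ∀ K t, |t| ≤ l₀ → K₀ ≤ K → Φf.BA K t ≤ BAi
  /-- display -/
  hmi : ∀ K, (μ K).real Set.univ ≤ mi
  /-- display (ρ) `FibreMass` (located, VOLUME type) -/
  hρ : ∀ K t, |t| ≤ l₀ → K₀ ≤ K →
    ∀ k ∈ badGMems (memA n F.L ℛ) jhalf (HIndex.termSet I) (kmemA n F.L hn (lt_of_lt_of_le (by norm_num) (two_le_L F)) ℛ) K,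
      ∑ τ ∈ fibre (kmemA n F.L hn (lt_of_lt_of_le (by norm_num) (two_le_L F)) ℛ) (HIndex.termSet I) K k,
        dmassOf ℛ Φf t τ ≤ W K * MULTOf (sharpT (φB K) (φR K)) k
  /-- the (γ) small-field mass floor -/
  c₀ : ℝ
  /-- the site budget -/
  n₁ : ℝ
  /-- the floor is positive -/
  c₀_pos : 0 < c₀
  /-- (γ) floor, run A -/
  floor : ∀ K, K₀ ≤ K → c₀ ≤ smallFieldMass D K (g₀ K)
  /-- (γ) floor, run B -/
  floor' : ∀ K, K₀ ≤ K → c₀ ≤ smallFieldMass D (K + 1) (g₀ (K + 1))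
  /-- site budget, run A -/
  sites : ∀ K, K₀ ≤ K → ((D.C ⟨K, F.m, g₀ K⟩).numSites K : ℝ) ≤ n₁
  /-- site budget, run B -/
  sites' : ∀ K, K₀ ≤ K → ((D.C ⟨K + 1, F.m, g₀ (K + 1)⟩).numSites (K + 1) : ℝ) ≤ n₁
  /-- display (S1c-opt, (c5)(i)): distinct partners at every join -/
  hDJ : ∀ K, K₀ ≤ K → ∀ τ ∈ HIndex.termSet I K, ∀ c ∈ ℛ.inputOf.liveCV K τ,
    DisjointJoins ((ℛ.inputOf.pedV K τ).toPGen id c)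
  /-- display (S1c-opt, (c5)(i)): constituents boxed at their birth levels -/
  hBB : ∀ K, K₀ ≤ K → ∀ τ ∈ HIndex.termSet I K, ∀ c ∈ ℛ.inputOf.liveCV K τ,
    BoxedBirths n F.L K (levelOf (runProfile F.L ℛ.R K) K) ((ℛ.inputOf.pedV K τ).toPGen id c)
  /-- RUN B v0.5: run B's history-indexed operations over ITS skeleton, per cutoff and source value -/
  RB : (K : ℕ) → ℝ → Repr172R (𝒢' K) (I' K)
  /-- RUN B: run B's dressed density after `K + 1` steps on its reference space -/
  ρB : (K : ℕ) → ℝ → Y (K + 1) → ℝ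
  /-- display ((1.72) holds for run B at cutoff `K + 1`) -/
  holdsB : ∀ K t V, ρB K t V = ∑ a : (I' (K + 1)).Adm, (RB (K + 1) t).term a V
  /-- display (integrability, run B) -/
  intB : ∀ K t a, ∀ ι ∈ (I' (K + 1)).LIdx a, Integrable ((RB (K + 1) t).eterm a ι) (νB (K + 1))
  /-- display (H2, run B) -/
  H2B : ∀ K t, |t| ≤ l₀ → K₀ ≤ K →
    ∫ U, Real.exp (t * T4GenFunBounds.prodObs (D.scheme g₀) (K + 1) os U) * D.dens (K + 1) (g₀ (K + 1)) 0 U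
        ∂fieldMeasure (F.P (K + 1)) 0 G = ∫ y, ρB K t y ∂νB (K + 1)
  /-- RUN B (S, NODE O): the truncation of run B's level-`(K+1)` terms onto run A's index -/
  trunc : ℕ → HIndex.Idx I' → HIndex.Idx I
  /-- display (S): the truncation maps run B's term set into run A's -/
  htr : ∀ K, K₀ ≤ K → ∀ τ' ∈ HIndex.termSet I' (K + 1), trunc K τ' ∈ HIndex.termSet I K
  /-- RUN B: per-term dead weights -/
  dB : ℕ → ℝ → HIndex.Idx I' → ℝ
  /-- RUN B: envelope -/
  mup : ℕ → ℝ → ℝ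
  /-- RUN B: sharp ∕ share letters of run B -/
  (sB' φB' : ℕ → ℕ → ℕ → ℝ)
  /-- RUN B: sharp ∕ share letters of run B -/
  (sR' φR' : ℕ → ℕ → ℝ)
  /-- display: the booked junction at run B's letters (for `priceM′` at run A's key) -/
  hRR' : ∀ K, K₀ ≤ K → RoundingRoomF C O F.L K (ℛ.R K) (D.C ⟨K, F.m, g₀ K⟩).flow.g (sB' K) (sR' K) (φB' K) (φR' K)
  /-- display (R «TRUNC»): run B's numerator reading per term, KEYED AT RUN A's KEYS -/
  upB : ∀ K t, |t| ≤ l₀ → K₀ ≤ K →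
    ∀ k ∈ badGMems (memA n F.L ℛ) jhalf (HIndex.termSet I) (kmemA n F.L hn (lt_of_lt_of_le (by norm_num) (two_le_L F)) ℛ) K,
      ∀ τ' ∈ HIndex.termSet I' (K + 1),
        trunc K τ' ∈ fibre (kmemA n F.L hn (lt_of_lt_of_le (by norm_num) (two_le_L F)) ℛ) (HIndex.termSet I) K k →
          Repr172R.weight νB RB t τ' ≤
            dB K t τ' * LIVEOf C K (ℛ.R K) (fun m => 2 ^ (d + 3) * Real.log (Φf.Λ K m)) (sharpT (sB' K) (sR' K)) k *
              mup K t
  /-- display (R «TRUNC»): run B's dead weights are nonnegative over the composite fibres -/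
  deadB_nonneg : ∀ K t, |t| ≤ l₀ → K₀ ≤ K →
    ∀ k ∈ badGMems (memA n F.L ℛ) jhalf (HIndex.termSet I) (kmemA n F.L hn (lt_of_lt_of_le (by norm_num) (two_le_L F)) ℛ) K,
      ∀ τ' ∈ HIndex.termSet I' (K + 1),
        trunc K τ' ∈ fibre (kmemA n F.L hn (lt_of_lt_of_le (by norm_num) (two_le_L F)) ℛ) (HIndex.termSet I) K k →
          0 ≤ dB K t τ'
  /-- display (ρ′) (located, VOLUME type): run B's fibre mass over the COMPOSITE fibre of a key -/
  resumB : ∀ K t, |t| ≤ l₀ → K₀ ≤ K →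
    ∀ k ∈ badGMems (memA n F.L ℛ) jhalf (HIndex.termSet I) (kmemA n F.L hn (lt_of_lt_of_le (by norm_num) (two_le_L F)) ℛ) K,
      ∑ τ' ∈ (HIndex.termSet I' (K + 1)).filter (fun τ' =>
          trunc K τ' ∈ fibre (kmemA n F.L hn (lt_of_lt_of_le (by norm_num) (two_le_L F)) ℛ) (HIndex.termSet I) K k),
        dB K t τ' ≤ MULTOf (sharpT (φB' K) (φR' K)) k
  /-- display: run B's envelope bound (at `Nup := e^{BA∞}·m∞·W∞`) -/
  mup_bd : ∀ K t, |t| ≤ l₀ → K₀ ≤ K → 0 ≤ mup K t ∧ mup K t ≤ Real.exp BAi * mi * Wi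
  /-- NE7c: the two runs' shell parts -/
  (shA shB : ℕ → ℝ → HIndex.Idx I → ℝ)
  /-- NE7c's shell weight budget -/
  Wsh : ℕ → ℝ
  /-- NE7c (S): the indicator shells' relative weight bound over this reading's terms -/
  shell : ShellWeightBound l₀ (HIndex.termSet I) (fun _ t => Repr172R.weight μ RA t) (weightB νB RB trunc) shA shB Wsh
  /-- NE7 core budget data -/
  (Cc Rr CcRec RrRec : ℕ → ℝ → HIndex.Idx I → ℝ)
  /-- NE7 core budget rates -/
  (ν u s₂ q₀ r s : ℕ → ℝ)
  /-- NE7 (S): the re-indexed per-term budget over this reading's bad classes -/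
  budget : ReindexedBudget l₀ vol (HIndex.termSet I) (fun K t τ => Repr172R.weight μ RA t τ - shA K t τ)
    (fun K t τ => weightB νB RB trunc K t τ - shB K t τ)
    (badOfClass (bstrOf Prod.fst (memA n F.L ℛ)) (HIndex.termSet I)
      (fun K _ => badClasses Prod.fst (memA n F.L ℛ) jhalf (HIndex.termSet I) K)) Cc Rr CcRec RrRec ν u s₂ q₀ r s
  /-- summable rates -/
  sum_r : Summable r
  /-- summable rates -/
  sum_u : Summable u
  /-- summable rates -/
  sum_s : Summable s
  /-- summable rates -/
  sum_s₂ : Summable s₂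

end Data

end

end Summit.QuantumFields.BalabanUV.T4Continuum.HistoryRealiseCellsRunAssemblyWTVSData
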